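import Summits.QuantumFields.YangMills.Theorems.BalabanStepParabolic.Negative.ForcedScalingLimit

/-!
# `BalabanStepParabolic` — negative-side support XV: the forced scaling limit, INTRINSIC form

Support file for crux `stmt-QuantumFields-9684` (`ParabolicTrajectory.BalabanStepParabolic`), extracted from the
standing disprover's work file `Cruxes/BalabanStepParabolic/Disproof.lean` §V (cycle 3); continuation of
`ForcedScalingLimit.lean`. Tree objects only.

`ForcedScalingLimit.forced_scaling_limit` quantifies over deep sequences inside the a-priori window
`2c₁k ≤ 1/g² − 1/g⋆²` of §L (worst-case growth `c₁g³` per step). An inhabitant whose coupling grows SLOWER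
stays in the region `(0, g⋆] × B̄_R` much longer, and its physically interesting deep points (arrival
couplings bounded away from `0`) may lie beyond that window. This file removes the restriction: admissibility
is the INTRINSIC condition "the orbit has couplings in `[0, τ₀]` and fibres in the basin up to its depth"
(`InRegion`, spelled out), which the window implies (`orbit_window`) but which is in general much weaker.

* `fibre_small_of_region`: in-region orbit points have fibres in the `δ`-ball from depth `i₀` on;
* `pair_estimate_of_region`, `cauchySeq_of_region`, `tendsto_of_region`, `limit_unique_of_region`: the §V.4
  chain under the intrinsic hypothesis;
* `smallness_mono`: the thresholds are downward closed in the cap;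
* **`forced_scaling_limit_of_region`** (odd `M`): a threshold `τmax > 0` such that for EVERY cap
  `τ₀ ∈ (0, τmax]` there is a graph `Q` with: along EVERY in-region(`τ₀`) deep sequence of Wilson orbit points
  with arrival couplings `→ t` the points converge to `Q t` and the genuine dilated Wilson data converge to
  `expect (Q t) (2L+1) n σ f`; in-region deep sequences exist for every such cap.
-/

namespace Summit.QuantumFields.YangMills.Theorems.BalabanStepParabolic.Negative

open scoped SchwartzMap
open MeasureTheory Filter Topology
open Literature.MathematicalPhysics.QuantumFieldTheory Literature.MathematicalPhysics.AQFT
open Literature.MathematicalPhysics.QuantumLattice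

noncomputable section

variable {G : Type} [Group G] [TopologicalSpace G] [IsTopologicalGroup G] [CompactSpace G]
  [MeasurableSpace G] [BorelSpace G] {r : LatticeRep G} {M : ℕ} (S : BalabanBanachStep G r M)

/-- **In-region orbit points have small fibres from depth `i₀` on.** If the orbit of the Wilson point
`(g, yW g)` (`g ∈ [0, g₀]`) has couplings in `[0, τ₀]` (`τ₀ ≤ δ`, `Cτ₀²/(1−θ') ≤ δ/2`) and fibres in the
basin up to depth `k`, then its fibres are in the `δ`-ball at every depth `j ∈ [i₀, k]`
(`θ'^{i₀} R ≤ δ/2`). [folklore] -/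
theorem fibre_small_of_region {τ₀ : ℝ} (hτδ : τ₀ ≤ S.δ) (hτδ2 : S.C * τ₀ ^ 2 / (1 - S.θ') ≤ S.δ / 2)
    {i₀ : ℕ} (hi₀ : S.θ' ^ i₀ * S.R ≤ S.δ / 2) {g : ℝ} (hg : g ∈ Set.Icc 0 S.g₀) (k : ℕ)
    (hreg : ∀ i ≤ k, (S.F^[i] (g, S.yW g)).1 ∈ Set.Icc 0 τ₀ ∧ ‖(S.F^[i] (g, S.yW g)).2‖ ≤ S.R) :
    ∀ j ≤ k, i₀ ≤ j → ‖(S.F^[j] (g, S.yW g)).2‖ ≤ S.δ := by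
  intro j hj hij
  have hdec := fibre_decay S hτδ (g, S.yW g) j (fun i hi => hreg i (hi.le.trans hj))
  have hθ'0 := S.θ'_nonneg
  have hθ'1 := S.θ'_lt_one
  have hR := S.R_pos
  have hyW : ‖S.yW g‖ ≤ S.R := S.norm_yW_le g hg
  have hpow : S.θ' ^ j ≤ S.θ' ^ i₀ := pow_le_pow_of_le_one hθ'0 hθ'1.le hij
  calc ‖(S.F^[j] (g, S.yW g)).2‖ ≤ S.θ' ^ j * ‖S.yW g‖ + S.C * τ₀ ^ 2 / (1 - S.θ') := hdec
    _ ≤ S.θ' ^ i₀ * S.R + S.δ / 2 := by gcongr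
    _ ≤ S.δ / 2 + S.δ / 2 := by gcongr
    _ = S.δ := by ring

/-- **Pair estimate, intrinsic form**: two in-region Wilson orbit points of depths `k, k' ≥ m₀ + i₀`
satisfy `‖Δy‖ ≤ λ|Δg| + ϑ^{m₀}·2δ`. [folklore] -/
theorem pair_estimate_of_region {τ₀ : ℝ} (hτδ : τ₀ ≤ S.δ)
    (hτδ2 : S.C * τ₀ ^ 2 / (1 - S.θ') ≤ S.δ / 2)
    (hsmall : S.C * τ₀ ^ 2 * (τ₀ + S.δ) + S.C * τ₀ ^ 3 * (2 * S.C * (2 * τ₀ + S.δ) / (1 - S.θ')) ≤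
      (1 - S.θ') / 2)
    {i₀ : ℕ} (hi₀ : S.θ' ^ i₀ * S.R ≤ S.δ / 2)
    {g g' : ℝ} (hg : g ∈ Set.Icc 0 S.g₀) (hg' : g' ∈ Set.Icc 0 S.g₀) {k k' m₀ : ℕ}
    (hreg : ∀ i ≤ k, (S.F^[i] (g, S.yW g)).1 ∈ Set.Icc 0 τ₀ ∧ ‖(S.F^[i] (g, S.yW g)).2‖ ≤ S.R)
    (hreg' : ∀ i ≤ k', (S.F^[i] (g', S.yW g')).1 ∈ Set.Icc 0 τ₀ ∧ ‖(S.F^[i] (g', S.yW g')).2‖ ≤ S.R)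
    (hmk : m₀ + i₀ ≤ k) (hmk' : m₀ + i₀ ≤ k') :
    ‖(S.F^[k] (g, S.yW g)).2 - (S.F^[k'] (g', S.yW g')).2‖ ≤
      (2 * S.C * (2 * τ₀ + S.δ) / (1 - S.θ')) * |(S.F^[k] (g, S.yW g)).1 - (S.F^[k'] (g', S.yW g')).1| +
        ((1 + S.θ') / 2) ^ m₀ * (2 * S.δ) := by
  have hθ'0 := S.θ'_nonneg
  have hθ'1 : 0 < 1 - S.θ' := by linarith [S.θ'_lt_one]
  by_cases hm0 : m₀ = 0
  · -- trivial: ‖Δy‖ ≤ 2δ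
    subst hm0
    have h1 : ‖(S.F^[k] (g, S.yW g)).2‖ ≤ S.δ :=
      fibre_small_of_region S hτδ hτδ2 hi₀ hg k hreg k le_rfl (by omega)
    have h2 : ‖(S.F^[k'] (g', S.yW g')).2‖ ≤ S.δ :=
      fibre_small_of_region S hτδ hτδ2 hi₀ hg' k' hreg' k' le_rfl (by omega)
    have hA : 0 ≤ (2 * S.C * (2 * τ₀ + S.δ) / (1 - S.θ')) *
        |(S.F^[k] (g, S.yW g)).1 - (S.F^[k'] (g', S.yW g')).1| := by
      have hτ0 : 0 ≤ τ₀ := (hreg 0 (Nat.zero_le _)).1.1.trans (hreg 0 (Nat.zero_le _)).1.2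
      have := S.C_pos.le; have := S.δ_pos.le
      positivity
    calc ‖(S.F^[k] (g, S.yW g)).2 - (S.F^[k'] (g', S.yW g')).2‖ ≤ S.δ + S.δ :=
          (norm_sub_le _ _).trans (add_le_add h1 h2)
      _ = ((1 + S.θ') / 2) ^ 0 * (2 * S.δ) := by ring
      _ ≤ _ := le_add_of_nonneg_left hA
  have hτ0 : 0 ≤ τ₀ := (hreg 0 (Nat.zero_le _)).1.1.trans (hreg 0 (Nat.zero_le _)).1.2
  -- split off the last m₀ steps
  set p := S.F^[k - m₀] (g, S.yW g) with hp
  set q := S.F^[k' - m₀] (g', S.yW g') with hq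
  have hP : S.F^[k] (g, S.yW g) = S.F^[m₀] p := by
    rw [hp, ← Function.iterate_add_apply, Nat.add_sub_cancel' (by omega)]
  have hP' : S.F^[k'] (g', S.yW g') = S.F^[m₀] q := by
    rw [hq, ← Function.iterate_add_apply, Nat.add_sub_cancel' (by omega)]
  have hB := fibre_small_of_region S hτδ hτδ2 hi₀ hg k hreg
  have hB' := fibre_small_of_region S hτδ hτδ2 hi₀ hg' k' hreg'
  have hsegp : ∀ i < m₀, (S.F^[i] p).1 ∈ Set.Icc 0 τ₀ ∧ ‖(S.F^[i] p).2‖ ≤ S.δ := by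
    intro i hi
    have e : S.F^[i] p = S.F^[k - m₀ + i] (g, S.yW g) := by
      rw [hp, ← Function.iterate_add_apply, add_comm]
    rw [e]
    exact ⟨(hreg _ (by omega)).1, hB _ (by omega) (by omega)⟩
  have hsegq : ∀ i < m₀, (S.F^[i] q).1 ∈ Set.Icc 0 τ₀ ∧ ‖(S.F^[i] q).2‖ ≤ S.δ := by
    intro i hi
    have e : S.F^[i] q = S.F^[k' - m₀ + i] (g', S.yW g') := by
      rw [hq, ← Function.iterate_add_apply, add_comm]
    rw [e]
    exact ⟨(hreg' _ (by omega)).1, hB' _ (by omega) (by omega)⟩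
  have hslave := slaving_estimate S hτ0 hτδ hsmall p q m₀ hsegp hsegq
  rw [← hP, ← hP'] at hslave
  have hp2 : ‖p.2‖ ≤ S.δ := by
    have := hB (k - m₀) (by omega) (by omega); rwa [hp]
  have hq2 : ‖q.2‖ ≤ S.δ := by
    have := hB' (k' - m₀) (by omega) (by omega); rwa [hq]
  have hpq : ‖p.2 - q.2‖ ≤ 2 * S.δ := (norm_sub_le _ _).trans (by linarith)
  have hϑ0 : 0 ≤ ((1 + S.θ') / 2) ^ m₀ := by positivity
  nlinarith [hslave, mul_le_mul_of_nonneg_left hpq hϑ0]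

/-- **In-region deep points are Cauchy when their couplings are** (intrinsic form). [folklore] -/
theorem cauchySeq_of_region {τ₀ : ℝ} (hτδ : τ₀ ≤ S.δ)
    (hτδ2 : S.C * τ₀ ^ 2 / (1 - S.θ') ≤ S.δ / 2)
    (hsmall : S.C * τ₀ ^ 2 * (τ₀ + S.δ) + S.C * τ₀ ^ 3 * (2 * S.C * (2 * τ₀ + S.δ) / (1 - S.θ')) ≤
      (1 - S.θ') / 2)
    {i₀ : ℕ} (hi₀ : S.θ' ^ i₀ * S.R ≤ S.δ / 2)
    (g : ℕ → ℝ) (k : ℕ → ℕ) (hg : ∀ j, g j ∈ Set.Icc 0 S.g₀)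
    (hreg : ∀ j, ∀ i ≤ k j, (S.F^[i] (g j, S.yW (g j))).1 ∈ Set.Icc 0 τ₀ ∧
      ‖(S.F^[i] (g j, S.yW (g j))).2‖ ≤ S.R)
    (hkinf : Tendsto k atTop atTop) (hc : CauchySeq fun j => (S.F^[k j] (g j, S.yW (g j))).1) :
    CauchySeq fun j => S.F^[k j] (g j, S.yW (g j)) := by
  have hθ'0 := S.θ'_nonneg
  have hθ'1 : 0 < 1 - S.θ' := by linarith [S.θ'_lt_one]
  have hC := S.C_pos.le
  have hδ := S.δ_pos
  have hτ0 : 0 ≤ τ₀ := (hreg 0 0 (Nat.zero_le _)).1.1.trans (hreg 0 0 (Nat.zero_le _)).1.2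
  set lam := 2 * S.C * (2 * τ₀ + S.δ) / (1 - S.θ') with hlam
  set ϑ := (1 + S.θ') / 2 with hϑ
  have hlam0 : 0 ≤ lam := by rw [hlam]; apply div_nonneg (by nlinarith) hθ'1.le
  have hϑ0 : 0 ≤ ϑ := by rw [hϑ]; linarith
  have hϑ1 : ϑ < 1 := by rw [hϑ]; linarith [S.θ'_lt_one]
  rw [Metric.cauchySeq_iff] at hc ⊢
  intro ε hε
  have hpow := (tendsto_pow_atTop_nhds_zero_of_lt_one hϑ0 hϑ1).mul_const (2 * S.δ)
  rw [zero_mul] at hpow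
  obtain ⟨m₀, hm₀⟩ := (hpow.eventually (eventually_lt_nhds (half_pos hε))).exists
  obtain ⟨N₂, hN₂⟩ := hc (ε / (2 * (lam + 1))) (by positivity)
  obtain ⟨N₁, hN₁⟩ := (hkinf.eventually (eventually_ge_atTop (m₀ + i₀))).exists_forall_of_atTop
  refine ⟨max N₁ N₂, fun j hj j' hj' => ?_⟩
  have hpair := pair_estimate_of_region S hτδ hτδ2 hsmall hi₀ (hg j) (hg j') (hreg j) (hreg j')
    (hN₁ j ((le_max_left _ _).trans hj)) (hN₁ j' ((le_max_left _ _).trans hj'))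
  have hcpl : dist (S.F^[k j] (g j, S.yW (g j))).1 (S.F^[k j'] (g j', S.yW (g j'))).1 <
      ε / (2 * (lam + 1)) := hN₂ j ((le_max_right _ _).trans hj) j' ((le_max_right _ _).trans hj')
  rw [Real.dist_eq] at hcpl
  have hε2 : ε / (2 * (lam + 1)) ≤ ε / 2 :=
    div_le_div_of_nonneg_left hε.le (by norm_num) (by nlinarith)
  have hfib : ‖(S.F^[k j] (g j, S.yW (g j))).2 - (S.F^[k j'] (g j', S.yW (g j'))).2‖ < ε := by
    have h1 : lam * |(S.F^[k j] (g j, S.yW (g j))).1 - (S.F^[k j'] (g j', S.yW (g j'))).1| ≤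
        lam * (ε / (2 * (lam + 1))) := mul_le_mul_of_nonneg_left hcpl.le hlam0
    have h2 : lam * (ε / (2 * (lam + 1))) ≤ ε / 2 := by
      rw [mul_div_assoc', div_le_div_iff₀ (by positivity) (by norm_num)]
      nlinarith
    linarith [hpair, hm₀]
  rw [Prod.dist_eq, Real.dist_eq, dist_eq_norm]
  exact max_lt (hcpl.trans_le (hε2.trans (by linarith))) hfib

/-- **Forced convergence of in-region deep points** with convergent arrival couplings. [folklore] -/
theorem tendsto_of_region {τ₀ : ℝ} (hτδ : τ₀ ≤ S.δ)
    (hτδ2 : S.C * τ₀ ^ 2 / (1 - S.θ') ≤ S.δ / 2)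
    (hsmall : S.C * τ₀ ^ 2 * (τ₀ + S.δ) + S.C * τ₀ ^ 3 * (2 * S.C * (2 * τ₀ + S.δ) / (1 - S.θ')) ≤
      (1 - S.θ') / 2)
    {i₀ : ℕ} (hi₀ : S.θ' ^ i₀ * S.R ≤ S.δ / 2)
    (g : ℕ → ℝ) (k : ℕ → ℕ) (hg : ∀ j, g j ∈ Set.Icc 0 S.g₀)
    (hreg : ∀ j, ∀ i ≤ k j, (S.F^[i] (g j, S.yW (g j))).1 ∈ Set.Icc 0 τ₀ ∧
      ‖(S.F^[i] (g j, S.yW (g j))).2‖ ≤ S.R)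
    (hkinf : Tendsto k atTop atTop)
    {t : ℝ} (hc : Tendsto (fun j => (S.F^[k j] (g j, S.yW (g j))).1) atTop (𝓝 t)) :
    ∃ q ∈ Set.Icc 0 S.δ ×ˢ Metric.closedBall (0 : S.E) S.R,
      Tendsto (fun j => S.F^[k j] (g j, S.yW (g j))) atTop (𝓝 q) := by
  have hCauchy := cauchySeq_of_region S hτδ hτδ2 hsmall hi₀ g k hg hreg hkinf hc.cauchySeq
  obtain ⟨q, hq⟩ := cauchySeq_tendsto_of_complete hCauchy
  refine ⟨q, ?_, hq⟩
  have hclosed : IsClosed (Set.Icc 0 S.δ ×ˢ Metric.closedBall (0 : S.E) S.R) :=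
    isClosed_Icc.prod Metric.isClosed_closedBall
  refine hclosed.mem_of_tendsto hq (Eventually.of_forall fun j => ?_)
  obtain ⟨h1, h2⟩ := hreg j (k j) le_rfl
  exact Set.mk_mem_prod ⟨h1.1, h1.2.trans hτδ⟩
    (by simpa [Metric.mem_closedBall, dist_zero_right] using h2)

/-- **The limit depends on the arrival coupling only** (intrinsic form). [folklore] -/
theorem limit_unique_of_region {τ₀ : ℝ} (hτδ : τ₀ ≤ S.δ)
    (hτδ2 : S.C * τ₀ ^ 2 / (1 - S.θ') ≤ S.δ / 2)
    (hsmall : S.C * τ₀ ^ 2 * (τ₀ + S.δ) + S.C * τ₀ ^ 3 * (2 * S.C * (2 * τ₀ + S.δ) / (1 - S.θ')) ≤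
      (1 - S.θ') / 2)
    {i₀ : ℕ} (hi₀ : S.θ' ^ i₀ * S.R ≤ S.δ / 2)
    {g g' : ℕ → ℝ} {k k' : ℕ → ℕ} (hg : ∀ j, g j ∈ Set.Icc 0 S.g₀) (hg' : ∀ j, g' j ∈ Set.Icc 0 S.g₀)
    (hreg : ∀ j, ∀ i ≤ k j, (S.F^[i] (g j, S.yW (g j))).1 ∈ Set.Icc 0 τ₀ ∧
      ‖(S.F^[i] (g j, S.yW (g j))).2‖ ≤ S.R)
    (hreg' : ∀ j, ∀ i ≤ k' j, (S.F^[i] (g' j, S.yW (g' j))).1 ∈ Set.Icc 0 τ₀ ∧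
      ‖(S.F^[i] (g' j, S.yW (g' j))).2‖ ≤ S.R)
    (hkinf : Tendsto k atTop atTop) (hkinf' : Tendsto k' atTop atTop) {t : ℝ} {q q' : ℝ × S.E}
    (hc : Tendsto (fun j => (S.F^[k j] (g j, S.yW (g j))).1) atTop (𝓝 t))
    (hc' : Tendsto (fun j => (S.F^[k' j] (g' j, S.yW (g' j))).1) atTop (𝓝 t))
    (hq : Tendsto (fun j => S.F^[k j] (g j, S.yW (g j))) atTop (𝓝 q))
    (hq' : Tendsto (fun j => S.F^[k' j] (g' j, S.yW (g' j))) atTop (𝓝 q')) : q = q' := by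
  have hθ'0 := S.θ'_nonneg
  have hϑ0 : 0 ≤ (1 + S.θ') / 2 := by linarith
  have hϑ1 : (1 + S.θ') / 2 < 1 := by linarith [S.θ'_lt_one]
  have h1 : q.1 = t := tendsto_nhds_unique hq.fst_nhds hc
  have h1' : q'.1 = t := tendsto_nhds_unique hq'.fst_nhds hc'
  have h2 : ∀ m₀ : ℕ, ‖q.2 - q'.2‖ ≤ ((1 + S.θ') / 2) ^ m₀ * (2 * S.δ) := by
    intro m₀
    have hev : ∀ᶠ j in atTop, ‖(S.F^[k j] (g j, S.yW (g j))).2 - (S.F^[k' j] (g' j, S.yW (g' j))).2‖ ≤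
        (2 * S.C * (2 * τ₀ + S.δ) / (1 - S.θ')) *
          |(S.F^[k j] (g j, S.yW (g j))).1 - (S.F^[k' j] (g' j, S.yW (g' j))).1| +
        ((1 + S.θ') / 2) ^ m₀ * (2 * S.δ) := by
      filter_upwards [hkinf.eventually (eventually_ge_atTop (m₀ + i₀)),
        hkinf'.eventually (eventually_ge_atTop (m₀ + i₀))] with j hj hj'
      exact pair_estimate_of_region S hτδ hτδ2 hsmall hi₀ (hg j) (hg' j) (hreg j) (hreg' j) hj hj'
    have hlim1 : Tendsto (fun j => ‖(S.F^[k j] (g j, S.yW (g j))).2 -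
        (S.F^[k' j] (g' j, S.yW (g' j))).2‖) atTop (𝓝 ‖q.2 - q'.2‖) :=
      (hq.snd_nhds.sub hq'.snd_nhds).norm
    have hlim2 : Tendsto (fun j => (2 * S.C * (2 * τ₀ + S.δ) / (1 - S.θ')) *
          |(S.F^[k j] (g j, S.yW (g j))).1 - (S.F^[k' j] (g' j, S.yW (g' j))).1| +
        ((1 + S.θ') / 2) ^ m₀ * (2 * S.δ)) atTop
        (𝓝 ((2 * S.C * (2 * τ₀ + S.δ) / (1 - S.θ')) * |t - t| + ((1 + S.θ') / 2) ^ m₀ * (2 * S.δ))) :=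
      (((hc.sub hc').abs).const_mul (2 * S.C * (2 * τ₀ + S.δ) / (1 - S.θ'))).add_const _
    have := le_of_tendsto_of_tendsto hlim1 hlim2 hev
    simpa using this
  have h3 : ‖q.2 - q'.2‖ ≤ 0 := by
    have hpow := (tendsto_pow_atTop_nhds_zero_of_lt_one hϑ0 hϑ1).mul_const (2 * S.δ)
    rw [zero_mul] at hpow
    exact ge_of_tendsto' hpow h2
  have h4 : q.2 = q'.2 := by
    have : ‖q.2 - q'.2‖ = 0 := le_antisymm h3 (norm_nonneg _)
    exact sub_eq_zero.1 (norm_eq_zero.1 this)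
  exact Prod.ext (h1.trans h1'.symm) h4

/-- **Thresholds are downward closed.** The smallness conditions of §V hold for every cap
`τ₀ ∈ [0, τmax]` once they hold at `τmax`. [folklore] -/
theorem smallness_mono {τ₀ τmax : ℝ} (h0 : 0 ≤ τ₀) (hle : τ₀ ≤ τmax)
    (hτδ2 : S.C * τmax ^ 2 / (1 - S.θ') ≤ S.δ / 2)
    (hsmall : S.C * τmax ^ 2 * (τmax + S.δ) +
      S.C * τmax ^ 3 * (2 * S.C * (2 * τmax + S.δ) / (1 - S.θ')) ≤ (1 - S.θ') / 2) :
    S.C * τ₀ ^ 2 / (1 - S.θ') ≤ S.δ / 2 ∧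
    S.C * τ₀ ^ 2 * (τ₀ + S.δ) + S.C * τ₀ ^ 3 * (2 * S.C * (2 * τ₀ + S.δ) / (1 - S.θ')) ≤
      (1 - S.θ') / 2 := by
  have hθ'1 : 0 < 1 - S.θ' := by linarith [S.θ'_lt_one]
  have hC := S.C_pos.le
  have hδ := S.δ_pos.le
  have hτmax : 0 ≤ τmax := h0.trans hle
  constructor
  · refine le_trans ?_ hτδ2
    gcongr
  · refine le_trans ?_ hsmall
    gcongr

/-- **FORCED SCALING LIMIT, intrinsic form (any inhabitant, odd `M`).** There is `τmax ∈ (0, min δ g₀]`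
such that for EVERY cap `τ₀ ∈ (0, τmax]`: (i) in-region deep sequences of Wilson orbit points with
convergent arrival couplings EXIST, and (ii) there is a graph `Q : ℝ → [0, δ] × B̄_R` such that along
EVERY sequence of Wilson orbit points `F^{k_j}(g_j, yW g_j)` whose orbits have couplings in `[0, τ₀]` and
fibres in the basin up to depth `k_j → ∞` — no a-priori window — and whose arrival couplings converge to
`t`, the points converge to `Q t` and the GENUINE centred Wilson `n`-point functions (`β_j = betaOf g_j`,
tori `M^{k_j}(2L+1)`, `k_j`-fold dilated test functions, normalisations `c g_j`) CONVERGE to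
`expect (Q t) (2L+1) n σ f`. For an inhabitant realising Bałaban's step with the physical slope these
sequences include, for every small `t > 0`, the physically tuned continuum limit at running coupling `t`;
`ScalingLimitReach` shows that for EVERY inhabitant the reachable `t` are `c₁t³`-dense. [folklore] -/
theorem forced_scaling_limit_of_region (hM : Odd M) :
    ∃ τmax : ℝ, 0 < τmax ∧ τmax ≤ S.g₀ ∧ τmax ≤ S.δ ∧
      τmax ≤ (min S.δ (min (Real.sqrt (1 / (2 * (S.b + S.C * (S.δ + S.R))))) (Real.sqrt ((1 - S.θ') * S.R / S.C)))) ∧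
    ∀ τ₀ : ℝ, 0 < τ₀ → τ₀ ≤ τmax →
    (∃ (g : ℕ → ℝ) (k : ℕ → ℕ) (t : ℝ), (∀ j, g j ∈ Set.Ioc 0 S.g₀) ∧
      (∀ j, ∀ i ≤ k j, (S.F^[i] (g j, S.yW (g j))).1 ∈ Set.Icc 0 τ₀ ∧
        ‖(S.F^[i] (g j, S.yW (g j))).2‖ ≤ S.R) ∧
      Tendsto k atTop atTop ∧ Tendsto (fun j => (S.F^[k j] (g j, S.yW (g j))).1) atTop (𝓝 t)) ∧
    ∃ Q : ℝ → ℝ × S.E, (∀ t, Q t ∈ Set.Icc 0 S.δ ×ˢ Metric.closedBall (0 : S.E) S.R) ∧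
    ∀ (g : ℕ → ℝ) (k : ℕ → ℕ) (t : ℝ),
      (∀ j, g j ∈ Set.Ioc 0 S.g₀) →
      (∀ j, ∀ i ≤ k j, (S.F^[i] (g j, S.yW (g j))).1 ∈ Set.Icc 0 τ₀ ∧
        ‖(S.F^[i] (g j, S.yW (g j))).2‖ ≤ S.R) →
      Tendsto k atTop atTop →
      Tendsto (fun j => (S.F^[k j] (g j, S.yW (g j))).1) atTop (𝓝 t) →
      Tendsto (fun j => S.F^[k j] (g j, S.yW (g j))) atTop (𝓝 (Q t)) ∧
      ∀ (L n : ℕ) (σ : Fin n → YMSpecies G) (f : Fin n → 𝓢(EuclideanSpace ℝ (Fin 4), ℝ)),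
        IsOffDiagonal (SchwartzMap.tensorFin n fun i => ofRealTest (f i)) →
        Tendsto (fun j => wilsonCentredSchwinger r.ρ (S.betaOf (g j))
            ((M ^ (k j) * (2 * L + 1) - 1) / 2) (S.c (g j)) n σ
            (fun i => (blockDilate M)^[k j] (f i))) atTop
          (𝓝 (S.expect (Q t) (2 * L + 1) n σ f)) := by
  classical
  obtain ⟨τmax, hτmax0, hτs, hτg₀, hτδ2max, hsmallmax⟩ := exists_τ₀ S
  obtain ⟨i₀, hi₀⟩ := exists_i₀ S
  have hτmaxδ : τmax ≤ S.δ := hτs.trans (gₛ_le_δ S)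
  refine ⟨τmax, hτmax0, hτg₀, hτmaxδ, hτs, fun τ₀ hτ0 hτle => ?_⟩
  obtain ⟨hτδ2, hsmall⟩ := smallness_mono S hτ0.le hτle hτδ2max hsmallmax
  have hτδ : τ₀ ≤ S.δ := hτle.trans hτmaxδ
  have hτs' : τ₀ ≤ (min S.δ (min (Real.sqrt (1 / (2 * (S.b + S.C * (S.δ + S.R))))) (Real.sqrt ((1 - S.θ') * S.R / S.C)))) := hτle.trans hτs
  have hτg₀' : τ₀ ≤ S.g₀ := hτle.trans hτg₀
  let Adm : (ℕ → ℝ) → (ℕ → ℕ) → ℝ → Prop := fun g k t =>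
    (∀ j, g j ∈ Set.Ioc 0 S.g₀) ∧
    (∀ j, ∀ i ≤ k j, (S.F^[i] (g j, S.yW (g j))).1 ∈ Set.Icc 0 τ₀ ∧
      ‖(S.F^[i] (g j, S.yW (g j))).2‖ ≤ S.R) ∧
      Tendsto k atTop atTop ∧ Tendsto (fun j => (S.F^[k j] (g j, S.yW (g j))).1) atTop (𝓝 t)
  have hIcc : ∀ {g : ℕ → ℝ}, (∀ j, g j ∈ Set.Ioc 0 S.g₀) → ∀ j, g j ∈ Set.Icc 0 S.g₀ :=
    fun h j => ⟨(h j).1.le, (h j).2⟩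
  have hlim : ∀ g k t, Adm g k t → ∃ q ∈ Set.Icc 0 S.δ ×ˢ Metric.closedBall (0 : S.E) S.R,
      Tendsto (fun j => S.F^[k j] (g j, S.yW (g j))) atTop (𝓝 q) :=
    fun g k t h => tendsto_of_region S hτδ hτδ2 hsmall hi₀ g k (hIcc h.1) h.2.1 h.2.2.1 h.2.2.2
  let Q : ℝ → ℝ × S.E := fun t =>
    if h : ∃ gk : (ℕ → ℝ) × (ℕ → ℕ), Adm gk.1 gk.2 t then
      Classical.choose (hlim _ _ t (Classical.choose_spec h))
    else (0, S.yW 0)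
  have hQmem : ∀ t, Q t ∈ Set.Icc 0 S.δ ×ˢ Metric.closedBall (0 : S.E) S.R := by
    intro t
    by_cases h : ∃ gk : (ℕ → ℝ) × (ℕ → ℕ), Adm gk.1 gk.2 t
    · simp only [Q, dif_pos h]
      exact (Classical.choose_spec (hlim _ _ t (Classical.choose_spec h))).1
    · simp only [Q, dif_neg h]
      exact S.wilson_mem_chart le_rfl S.δ_pos.le S.g₀_pos.le
  -- existence: the window sequence of `exists_deep_sequence` is in-region
  have hex0 : ∃ (g : ℕ → ℝ) (k : ℕ → ℕ) (t : ℝ), Adm g k t := by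
    obtain ⟨g, k, t, hg, hk, hkinf, hc⟩ := exists_deep_sequence S hτ0 hτs' hτg₀'
    refine ⟨g, k, t, fun j => ⟨(hg j).1, (hg j).2.trans hτg₀'⟩, fun j i hi => ?_, hkinf, hc⟩
    have hw := orbit_window S hτs' (hg j).1 (hg j).2 ((hg j).2.trans hτg₀') (k j) (hk j) i hi
    exact ⟨⟨hw.1.le, hw.2.1⟩, hw.2.2⟩
  refine ⟨hex0, Q, hQmem, fun g k t hg hreg hkinf hc => ?_⟩
  have hadm : Adm g k t := ⟨hg, hreg, hkinf, hc⟩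
  have hex : ∃ gk : (ℕ → ℝ) × (ℕ → ℕ), Adm gk.1 gk.2 t := ⟨(g, k), hadm⟩
  have hch := Classical.choose_spec hex
  have hchlim := Classical.choose_spec (hlim _ _ t hch)
  have hQt : Q t = Classical.choose (hlim _ _ t hch) := by simp only [Q, dif_pos hex]
  obtain ⟨q', -, hq'⟩ := hlim g k t hadm
  have heq : q' = Q t := by
    rw [hQt]
    exact limit_unique_of_region S hτδ hτδ2 hsmall hi₀ (hIcc hg) (hIcc hch.1) hreg hch.2.1 hkinf
      hch.2.2.1 hc hch.2.2.2 hq' hchlim.2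
  have hconv : Tendsto (fun j => S.F^[k j] (g j, S.yW (g j))) atTop (𝓝 (Q t)) := heq ▸ hq'
  refine ⟨hconv, fun L n σ f hf => ?_⟩
  have hkI : ∀ j, ∀ i ≤ k j, (S.F^[i] (g j, S.yW (g j))).1 ∈ Set.Icc 0 S.δ ∧
      ‖(S.F^[i] (g j, S.yW (g j))).2‖ ≤ S.R :=
    fun j i hi => ⟨⟨(hreg j i hi).1.1, (hreg j i hi).1.2.trans hτδ⟩, (hreg j i hi).2⟩
  exact tendsto_wilson_of_tendsto_orbit S hM hg hkI (hQmem t) hconv L n σ f hf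

end

end Summit.QuantumFields.YangMills.Theorems.BalabanStepParabolic.Negative
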